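import Mathlib
import Literature.MathematicalPhysics.QuantumFieldTheory.IsingGaugeSwitchingLemma
import Literature.MathematicalPhysics.QuantumFieldTheory.PottsGaugeWilsonLoopMonotonicity
import HarnessLib

/-!
# The high-temperature expansion of Ising (`ℤ₂`) lattice gauge theory and its coupling with the
# random-current model (Forsström–Viklund 2025, §1.3 and Theorem 1.3 (a), (b); Prop. 6.7, lower
# half) — PROVED on the finite torus

Companion of `IsingGaugeRandomCurrents` (Theorem 1.1: `Z_β[γ] = |Ω¹| Σ_{n ∈ 𝒞_γ} w(n)`, currents
`n : {plaquettes} → ℤ_{≥0}`, `𝒞_γ = {n : ∂(n mod 2) = γ}`, `w(n) = ∏_p (2β)^{n(p)}/n(p)!`) and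
`IsingGaugeSwitchingLemma` (Lemma 1.2). Source:

* M. P. Forsström, F. Viklund, *Current expansion and couplings for Ising lattice gauge theory*,
  arXiv:2502.19942 [ForsstromViklund2025currents] (read on the arXiv TeX source of v2), §1.3: the
  first display of §1.3, the **high-temperature expansion**
  `Z_{N,β}[γ] = |Ω¹(B_N,ℤ₂)| (cosh 2β)^{|C₂(B_N)⁺|} Σ_{ω ∈ Ω²(B_N,ℤ₂) : δω = γ} (tanh 2β)^{|(supp ω)⁺|}`
  ("for a proof, see, e.g., [mmm1979]" = [MarraMiraclesole1979], §3 eq. (5), p. 236: the `tanh` expansion of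
  the partition function over plaquette sets `S` with boundary `∂S`); the *high-temperature model with
  boundary `γ`*, `P^γ_{B_N,β}(ω) ∝ (tanh 2β)^{|supp ω|}` on `𝒫^{ht}_γ = {ω : δω = γ}`; the *random
  current model with boundary `γ`*, `𝐏^γ_{B_N,β}(n) = w(n)/Σ_{m ∈ 𝒞_γ} w(m)` on `𝒞_γ`, and its
  percolation process `n̂ = 𝟙(n > 0) ∼ 𝐏̂^γ_{B_N,β}`; **Theorem 1.3**: for `β > 0`, `n ∼ 𝐏^γ`,
  `η ∼ P^γ`, `X₁ ∼ Ψ_{1-1/cosh 2β}` independent Bernoulli plaquette percolation: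
  **(a)** `n mod 2 ∼ P^γ_{B_N,β}`; **(b)** `n̂ := max(η, X₁) ∼ 𝐏̂^γ_{B_N,β}` (proof, §5: given the
  parity, `𝐏(n(p) ≥ 1 ∣ n(p) even) = (cosh 2β - 1)/cosh 2β`); §6 **Proposition 6.7**:
  `Ψ_{1-1/cosh 2β} ≤ 𝐏̂⁰_{B_N,β} ≤ Ψ_{1-e^{-4β}}` (stochastic domination).

## Scope (read this first)

Gauge group `ℤ₂` only; finite torus `𝕋^d_L` (reading R1 of `IsingGaugeRandomCurrents`: the source
works on a box `B_N` with free boundary conditions; all identities here are local algebra on a finite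
cell complex). Nothing here bears on the Yang–Mills mass gap or on `BalabanLadder.IR`; in the `ym`
ladder only the conditional finite-`𝕋⁴` rung `BalabanLadder.UV` is closed by any route. Typed for the
`ym-ir` census row on random currents (A9: "Thm 1.3 (couplings) not typed").

## What is typed (transcriber's form, flagged)

* COUPLINGS AS PUSH-FORWARD IDENTITIES. "If `η ∼ P^γ` and `X ∼ Ψ_r` are independent then
  `max(η, X) ∼ Q`" is typed as the identity of finite(ly supported) laws
  `Q(P) = Σ_η P^γ(η) Ψ_r({X : supp η ∪ X = P})` for every plaquette set `P` (`max` of `0/1`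
  configurations = union of supports); "`f(n) ∼ Q` for `n ∼ 𝐏^γ`" as `Σ'_{n : f(n) = y} 𝐏^γ(n) = Q(y)`.
  No measure theory is needed (the tree's `PlaquetteRC.prob/eventProb` conventions, reading R7).
* `2`-forms mod `2` on the positively oriented plaquettes are functions `η : Plaquette d L → ZMod 2`;
  `δω = γ` of the source (its co-differential) is `bd₂ η = γ` (`PottsGaugeEdwardsSokal.bd₂ = δᵀ`,
  reading R3 of `IsingGaugeRandomCurrents`); Bernoulli plaquette percolation `Ψ_r` is the `q = 1`
  plaquette random-cluster model `PlaquetteRC.prob F r 1` / `eventProb F r 1` (`partitionFn_one`),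
  with the conventional coefficient field `F = ZMod 2` (immaterial for `q = 1`).
* On the torus a loop need not bound; the normalised statements assume `γ` is a `ℤ₂`-boundary
  (`∃ c, bd₂ c = γ`, automatic in `B_N`) and `β > 0` as printed. The un-normalised fibre identities
  hold for every `β` and `γ`. Theorem 1.3 is printed for `γ` a loop and Prop. 6.7 for `γ = 0`; the
  lower half of Prop. 6.7 is proved here for every boundary `γ` (same proof).

## Contents (everything PROVED; no named fact)

* `hasSum_pi_of_summable_norm` — `Σ_{n ∈ ℕ^ι} ∏ᵢ fᵢ(nᵢ) = ∏ᵢ Σ_k fᵢ(k)` for absolutely summable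
  `fᵢ` (finite `ι`); `hasSum_pow_div_factorial_of_parity` (`Σ_{k ≡ e} x^k/k! = cosh x ∣ sinh x`),
  `hasSum_pow_div_factorial_of_parity_of_iff` (the same with `k ≠ 0` prescribed);
* `parity n = n mod 2`, `supp`, the high-temperature model `htWeight`/`htSum`/`htProb`, the
  random-current model `curSum`/`curProb`, the percolation law `percProb` (`𝐏̂^γ_β`);
* fibres of `n ↦ n mod 2`: `hasSum_currentWeight_parity`, `hasSum_currentWeight_source_parity`;
  `loopNumerator_eq_htSum` (the **high-temperature expansion** of §1.3, PROVED from Theorem 1.1);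
  **Theorem 1.3 (a)** `tsum_curProb_parity_eq_htProb`;
* fibres of `n ↦ (n mod 2, n̂)`: `hasSum_currentWeight_parity_supp`, `prod_traceFactor_eq`;
  `bernoulli_eventProb_union_eq` (`Ψ_r(supp η ∪ X = P)`); **Theorem 1.3 (b)** `hasSum_curProb_supp`,
  `tsum_curProb_supp_eq`; `percProb_eq_sum`; **Prop. 6.7 (lower half)** `bernoulli_le_percProb`
  (`Ψ_{1-1/cosh 2β}(E) ≤ 𝐏̂^γ_β(E)` for increasing `E`).

Theorem 1.3 (c), (d) (the random-cluster model with boundary `γ`) and the upper half of Prop. 6.7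
are typed in the companion `IsingGaugeRandomClusterCoupling`.
-/

open Finset

namespace Literature.MathematicalPhysics.QuantumFieldTheory

namespace IsingGaugeCurrents

open LatticeForm PlaquetteRC

variable {d L : ℕ} [NeZero L]

/-! ### An analytic lemma: finite products of absolutely summable series -/

/-- Induction predicate of `hasSum_pi_of_summable_norm` (named: the type-induction principle
`Fintype.induction_empty_option` is applied to it). [folklore] -/
private def PiProdHasSum (α : Type) [Fintype α] : Prop :=
  ∀ (f : α → ℕ → ℝ) (a : α → ℝ), (∀ i, Summable (fun k => ‖f i k‖)) →
    (∀ i, HasSum (f i) (a i)) → HasSum (fun n : α → ℕ => ∏ i, f i (n i)) (∏ i, a i)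

/-- The induction behind `hasSum_pi_of_summable_norm`. [folklore] -/
private theorem piProdHasSum_all (ι : Type) [Fintype ι] : PiProdHasSum ι := by
  refine Fintype.induction_empty_option (P := PiProdHasSum) ?_ ?_ ?_ ι
  · -- transport along an equivalence of index types
    intro α κ _ e hα f a hn h
    letI : Fintype α := Fintype.ofEquiv κ e.symm
    have h' := hα (fun i => f (e i)) (fun i => a (e i)) (fun i => hn _) (fun i => h _)
    have hw : (∏ i : α, a (e i)) = ∏ j : κ, a j :=
      Fintype.prod_equiv e (fun i => a (e i)) a (fun _ => rfl)
    rw [hw] at h'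
    have key : (fun m : κ → ℕ => ∏ j, f j (m j)) =
        (fun n : α → ℕ => ∏ i, f (e i) (n i)) ∘ (e.symm.arrowCongr (Equiv.refl ℕ)) := by
      funext m
      simp only [Function.comp_apply, Equiv.arrowCongr_apply, Equiv.coe_refl, Equiv.symm_symm]
      exact (Fintype.prod_equiv e (fun i => f (e i) ((m ∘ e) i)) (fun j => f j (m j))
        (fun _ => rfl)).symm
    rw [key]
    exact (Equiv.hasSum_iff _).mpr h'
  · -- empty index type
    intro f a _ _
    have hfun : (fun n : PEmpty.{1} → ℕ => ∏ i, f i (n i)) = fun _ => 1 := by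
      funext n; simp
    rw [hfun]
    simp only [Finset.univ_eq_empty, Finset.prod_empty]
    have := hasSum_fintype (fun _ : PEmpty.{1} → ℕ => (1 : ℝ))
    simp only [Finset.univ_unique, Finset.sum_singleton] at this
    exact this
  · -- adjoin one index: Cauchy product with the induction hypothesis
    intro α _ ih f a hn h
    set F : ℕ → ℝ := f none with hFdef
    set G : (α → ℕ) → ℝ := fun m => ∏ i, f (some i) (m i) with hGdef
    have hF : HasSum F (a none) := h none
    have hG : HasSum G (∏ i, a (some i)) :=
      ih (fun i => f (some i)) (fun i => a (some i)) (fun i => hn _) (fun i => h _)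
    have hFn : Summable (fun k : ℕ => ‖F k‖) := hn none
    have hGn : Summable (fun m : α → ℕ => ‖G m‖) := by
      have hG' := ih (fun i k => ‖f (some i) k‖) (fun i => ∑' k, ‖f (some i) k‖)
        (fun i => by simpa only [norm_norm] using hn (some i)) (fun i => (hn (some i)).hasSum)
      refine hG'.summable.congr fun m => ?_
      rw [hGdef, norm_prod]
    have hFG : Summable (fun x : ℕ × (α → ℕ) => F x.1 * G x.2) :=
      summable_mul_of_summable_norm hFn hGn
    have hprod : HasSum (fun x : ℕ × (α → ℕ) => F x.1 * G x.2)
        (a none * ∏ i, a (some i)) := HasSum.mul hF hG hFG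
    rw [Fintype.prod_option]
    have key : (fun n : Option α → ℕ => ∏ o, f o (n o)) =
        (fun x : ℕ × (α → ℕ) => F x.1 * G x.2) ∘
          (Equiv.piOptionEquivProd (β := fun _ : Option α => ℕ)) := by
      funext n
      rw [Function.comp_apply, Fintype.prod_option, hFdef, hGdef]
      rfl
    rw [key]
    exact (Equiv.hasSum_iff _).mpr hprod

/-- **Finite products of series**: for a finite index type `ι` and absolutely summable real series
`fᵢ` with sums `aᵢ`, `Σ_{n : ι → ℕ} ∏ᵢ fᵢ(nᵢ) = ∏ᵢ aᵢ` (the multi-index rearrangement behind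
"given the parities, the `n(p)` are independent", proof of Theorem 1.3 (b)).
[cite: ForsstromViklund2025currents, §5 proof of Thm. 1.3 (b)] -/
theorem hasSum_pi_of_summable_norm (ι : Type) [Fintype ι] (f : ι → ℕ → ℝ) (a : ι → ℝ)
    (hn : ∀ i, Summable (fun k => ‖f i k‖)) (h : ∀ i, HasSum (f i) (a i)) :
    HasSum (fun n : ι → ℕ => ∏ i, f i (n i)) (∏ i, a i) :=
  piProdHasSum_all ι f a hn h

/-- Restricted exponential series are absolutely summable: `Σ_k ‖𝟙[P(k)] x^k/k!‖ < ∞`.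
[cite: ForsstromViklund2025currents, §5 proof of Thm. 1.3 (b)] -/
theorem summable_norm_ite_pow_div_factorial (x : ℝ) (P : ℕ → Prop) [DecidablePred P] :
    Summable (fun k : ℕ => ‖(if P k then x ^ k / (k.factorial : ℝ) else 0)‖) := by
  have h : Summable (fun k : ℕ => ‖x‖ ^ k / (k.factorial : ℝ)) :=
    NormedSpace.expSeries_div_summable (𝔸 := ℝ) ‖x‖
  refine Summable.of_nonneg_of_le (fun k => norm_nonneg _) (fun k => ?_) h
  split_ifs
  · rw [norm_div, norm_pow, Real.norm_natCast]
  · rw [norm_zero]; positivity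

/-! ### Parity-restricted exponential series -/

/-- `c(x, e) = Σ_{k ≡ e (mod 2)} x^k/k!`: `cosh x` for `e = 0` and `sinh x` for `e = 1`
(the factors `Σ_{m even} (2β)^m/m!`, `Σ_{m odd} (2β)^m/m!` of the printed proof).
[cite: ForsstromViklund2025currents, §5 proof of Thm. 1.3 (b)] -/
noncomputable def parityFactor (x : ℝ) (e : ZMod 2) : ℝ := if e = 0 then Real.cosh x else Real.sinh x

/-- The two elements of `ℤ₂`. [folklore] -/
private theorem zmod_two_cases (e : ZMod 2) : e = 0 ∨ e = 1 := by decide +revert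

/-- `Σ_{k ≡ e (mod 2)} x^k/k! = cosh x` (`e = 0`), `= sinh x` (`e = 1`).
[cite: ForsstromViklund2025currents, §5 proof of Thm. 1.3 (b)] -/
theorem hasSum_pow_div_factorial_of_parity (x : ℝ) (e : ZMod 2) :
    HasSum (fun k : ℕ => if (k : ZMod 2) = e then x ^ k / (k.factorial : ℝ) else 0)
      (parityFactor x e) := by
  have h2k : ∀ k : ℕ, ((2 * k : ℕ) : ZMod 2) = 0 := fun k =>
    ZMod.natCast_eq_zero_iff_even.mpr (even_two_mul k)
  have h2k1 : ∀ k : ℕ, ((2 * k + 1 : ℕ) : ZMod 2) = 1 := fun k =>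
    ZMod.natCast_eq_one_iff_odd.mpr (odd_two_mul_add_one k)
  have h10 : (1 : ZMod 2) ≠ 0 := by decide
  set g : ℕ → ℝ := fun k => if (k : ZMod 2) = e then x ^ k / (k.factorial : ℝ) else 0 with hg
  rcases zmod_two_cases e with he | he
  · have hev : (fun k : ℕ => g (2 * k)) = fun k : ℕ => x ^ (2 * k) / ((2 * k).factorial : ℝ) := by
      funext k; rw [hg]; exact if_pos (by rw [h2k, he])
    have hodd : (fun k : ℕ => g (2 * k + 1)) = fun _ => 0 := by
      funext k; rw [hg]; exact if_neg (by rw [h2k1, he]; exact h10)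
    have h1 : HasSum (fun k : ℕ => g (2 * k)) (Real.cosh x) := by
      rw [hev]; exact Real.hasSum_cosh x
    have h2 : HasSum (fun k : ℕ => g (2 * k + 1)) 0 := by
      rw [hodd]; exact hasSum_zero
    have h12 := HasSum.even_add_odd h1 h2
    rw [add_zero] at h12
    rw [parityFactor, if_pos he]
    exact h12
  · have hev : (fun k : ℕ => g (2 * k)) = fun _ => 0 := by
      funext k; rw [hg]; exact if_neg (by rw [h2k, he]; exact h10.symm)
    have hodd : (fun k : ℕ => g (2 * k + 1)) =
        fun k : ℕ => x ^ (2 * k + 1) / ((2 * k + 1).factorial : ℝ) := by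
      funext k; rw [hg]; exact if_pos (by rw [h2k1, he])
    have h1 : HasSum (fun k : ℕ => g (2 * k)) 0 := by
      rw [hev]; exact hasSum_zero
    have h2 : HasSum (fun k : ℕ => g (2 * k + 1)) (Real.sinh x) := by
      rw [hodd]; exact Real.hasSum_sinh x
    have h12 := HasSum.even_add_odd h1 h2
    rw [zero_add] at h12
    rw [parityFactor, if_neg (by rw [he]; exact h10)]
    exact h12

/-- `t(x, e, b) = Σ {x^k/k! : k ≡ e (mod 2), (k ≠ 0) ⇔ b}`: `cosh x - 1`, `1`, `sinh x`, `0` for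
`(e, b) = (0, ⊤), (0, ⊥), (1, ⊤), (1, ⊥)` (the conditional probabilities
`𝐏(n̂(p) = 1 ∣ n(p) even) = (cosh 2β - 1)/cosh 2β`, `𝐏(n̂(p) = 1 ∣ n(p) odd) = 1` of the printed proof,
before normalisation). [cite: ForsstromViklund2025currents, §5 proof of Thm. 1.3 (b)] -/
noncomputable def traceFactor (x : ℝ) (e : ZMod 2) (b : Prop) [Decidable b] : ℝ :=
  if e = 0 then (if b then Real.cosh x - 1 else 1) else (if b then Real.sinh x else 0)

/-- `Σ_{k ≡ e, (k ≠ 0) ⇔ b} x^k/k! = t(x, e, b)`. [cite: ForsstromViklund2025currents, §5 proof of Thm. 1.3 (b)] -/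
theorem hasSum_pow_div_factorial_of_parity_of_iff (x : ℝ) (e : ZMod 2) (b : Prop) [Decidable b] :
    HasSum (fun k : ℕ => if (k : ZMod 2) = e ∧ (k ≠ 0 ↔ b) then x ^ k / (k.factorial : ℝ) else 0)
      (traceFactor x e b) := by
  have hpar := hasSum_pow_div_factorial_of_parity x e
  have h10 : (1 : ZMod 2) ≠ 0 := by decide
  have h00 : ((0 : ℕ) : ZMod 2) = 0 := Nat.cast_zero
  rcases zmod_two_cases e with he | he
  · by_cases hb : b
    · -- even and non-zero: `cosh x - 1`
      have hfun : (fun k : ℕ => if (k : ZMod 2) = e ∧ (k ≠ 0 ↔ b) then x ^ k / (k.factorial : ℝ) else 0)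
          = fun k : ℕ => if k = 0 then 0 else
              (if (k : ZMod 2) = e then x ^ k / (k.factorial : ℝ) else 0) := by
        funext k
        by_cases hk : k = 0
        · rw [if_pos hk, if_neg]
          rintro ⟨_, h⟩
          exact (h.mpr hb) hk
        · rw [if_neg hk]
          by_cases hke : (k : ZMod 2) = e
          · rw [if_pos ⟨hke, iff_of_true hk hb⟩, if_pos hke]
          · rw [if_neg (fun h => hke h.1), if_neg hke]
      rw [hfun]
      have h := hasSum_ite_sub_hasSum hpar 0
      have h0 : (if ((0 : ℕ) : ZMod 2) = e then x ^ 0 / ((0 : ℕ).factorial : ℝ) else 0) = 1 := by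
        rw [if_pos (by rw [h00, he])]; simp
      rw [h0, parityFactor, if_pos he] at h
      rw [traceFactor, if_pos he, if_pos hb]
      exact h
    · -- even and zero: only `k = 0`
      have hfun : (fun k : ℕ => if (k : ZMod 2) = e ∧ (k ≠ 0 ↔ b) then x ^ k / (k.factorial : ℝ) else 0)
          = fun k : ℕ => if k = 0 then 1 else 0 := by
        funext k
        by_cases hk : k = 0
        · rw [if_pos hk, if_pos ⟨by rw [hk, h00, he], iff_of_false (fun h => h hk) hb⟩, hk]; simp
        · rw [if_neg hk, if_neg]
          rintro ⟨_, h⟩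
          exact hb (h.mp hk)
      rw [hfun, traceFactor, if_pos he, if_neg hb]
      exact hasSum_ite_eq (0 : ℕ) (1 : ℝ)
  · by_cases hb : b
    · -- odd (hence non-zero): `sinh x`
      have hfun : (fun k : ℕ => if (k : ZMod 2) = e ∧ (k ≠ 0 ↔ b) then x ^ k / (k.factorial : ℝ) else 0)
          = fun k : ℕ => if (k : ZMod 2) = e then x ^ k / (k.factorial : ℝ) else 0 := by
        funext k
        by_cases hke : (k : ZMod 2) = e
        · have hk : k ≠ 0 := by
            rintro rfl
            rw [h00, he] at hke
            exact h10 hke.symm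
          rw [if_pos ⟨hke, iff_of_true hk hb⟩, if_pos hke]
        · rw [if_neg (fun h => hke h.1), if_neg hke]
      rw [hfun, traceFactor, if_neg (by rw [he]; exact h10), if_pos hb]
      rw [parityFactor, if_neg (by rw [he]; exact h10)] at hpar
      exact hpar
    · -- odd and zero: impossible
      have hfun : (fun k : ℕ => if (k : ZMod 2) = e ∧ (k ≠ 0 ↔ b) then x ^ k / (k.factorial : ℝ) else 0)
          = fun _ => 0 := by
        funext k
        rw [if_neg]
        rintro ⟨hke, h⟩
        have hk : k = 0 := by
          by_contra hk
          exact hb (h.mp hk)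
        rw [hk, h00, he] at hke
        exact h10 hke.symm
      rw [hfun, traceFactor, if_neg (by rw [he]; exact h10), if_neg hb]
      exact hasSum_zero

/-! ### Parity and trace of a current; the high-temperature and the random-current models -/

/-- `n mod 2 ∈ Ω²(𝕋; ℤ₂)`: the parity of a current. [cite: ForsstromViklund2025currents, Thm. 1.3 (a)] -/
def parity (n : Current d L) : Plaquette d L → ZMod 2 := fun p => (n p : ZMod 2)

/-- The support `{p : f(p) ≠ 0}` of a plaquette function as a finset; for a current `n` this is the
percolation configuration `n̂ = 𝟙(n > 0)`, for a `ℤ₂` `2`-form `η` it is `(supp η)⁺`.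
[cite: ForsstromViklund2025currents, §1.3 (n̂ = 𝟙(n > 0), (supp ω)⁺)] -/
def supp {M : Type*} [Zero M] [DecidableEq M] (f : Plaquette d L → M) : Finset (Plaquette d L) :=
  Finset.univ.filter fun p => f p ≠ 0

/-- Membership in the support. [cite: ForsstromViklund2025currents, §1.3] -/
@[simp] theorem mem_supp {M : Type*} [Zero M] [DecidableEq M] (f : Plaquette d L → M)
    (p : Plaquette d L) : p ∈ supp f ↔ f p ≠ 0 := by
  simp [supp]

/-- `n ∈ 𝒞_γ ⇔ ∂(n mod 2) = γ` (definitional). [cite: ForsstromViklund2025currents, §1.2 eq. (1.1)] -/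
theorem isSourceOf_iff_parity (γ : Site d L → Fin d → ZMod 2) (n : Current d L) :
    IsSourceOf γ n ↔ bd₂ (parity n) = γ := Iff.rfl

/-- The high-temperature weight `(tanh 2β)^{|(supp ω)⁺|}` of a `ℤ₂` `2`-form.
[cite: ForsstromViklund2025currents, §1.3 (P^γ_{B_N,β})] -/
noncomputable def htWeight (β : ℝ) (η : Plaquette d L → ZMod 2) : ℝ :=
  Real.tanh (2 * β) ^ (supp η).card

/-- The high-temperature partition sum `Σ_{ω : δω = γ} (tanh 2β)^{|supp ω|}` over `𝒫^{ht}_γ`.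
[cite: ForsstromViklund2025currents, §1.3 (high-temperature expansion, 𝒫^{ht}_γ)] -/
noncomputable def htSum (β : ℝ) (γ : Site d L → Fin d → ZMod 2) : ℝ :=
  ∑ η : Plaquette d L → ZMod 2, if bd₂ η = γ then htWeight β η else 0

/-- The high-temperature model with boundary `γ`:
`P^γ_β(ω) = 𝟙[δω = γ] (tanh 2β)^{|supp ω|} / Σ_{ω' ∈ 𝒫^{ht}_γ} (tanh 2β)^{|supp ω'|}`.
[cite: ForsstromViklund2025currents, §1.3 (P^γ_{B_N,β})] -/
noncomputable def htProb (β : ℝ) (γ : Site d L → Fin d → ZMod 2) (η : Plaquette d L → ZMod 2) : ℝ :=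
  (if bd₂ η = γ then htWeight β η else 0) / htSum β γ

/-- The random-current partition sum `Σ_{m ∈ 𝒞_γ} w(m)` (`= Z_β[γ]/|Ω¹|` by Theorem 1.1).
[cite: ForsstromViklund2025currents, §1.3 (𝐏^γ_{B_N,β})] -/
noncomputable def curSum (β : ℝ) (γ : Site d L → Fin d → ZMod 2) : ℝ :=
  ∑' n : Current d L, (if IsSourceOf γ n then currentWeight β n else 0)

/-- The random-current model with boundary `γ`: `𝐏^γ_β(n) = 𝟙[n ∈ 𝒞_γ] w(n) / Σ_{m ∈ 𝒞_γ} w(m)`.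
[cite: ForsstromViklund2025currents, §1.3 (𝐏^γ_{B_N,β})] -/
noncomputable def curProb (β : ℝ) (γ : Site d L → Fin d → ZMod 2) (n : Current d L) : ℝ :=
  (if IsSourceOf γ n then currentWeight β n else 0) / curSum β γ

/-- The random-current percolation law `𝐏̂^γ_β(E) = 𝐏^γ_β(n̂ ∈ E)` of `n̂ = 𝟙(n > 0)` on events
`E` of plaquette sets. [cite: ForsstromViklund2025currents, §1.3 (𝐏̂^γ_{B_N,β})] -/
noncomputable def percProb (β : ℝ) (γ : Site d L → Fin d → ZMod 2)
    (E : Set (Finset (Plaquette d L))) [DecidablePred (· ∈ E)] : ℝ :=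
  ∑' n : Current d L, (if supp n ∈ E then curProb β γ n else 0)

/-- `Σ_{m ∈ 𝒞_γ} w(m) = Z_β[γ] / |Ω¹(𝕋; ℤ₂)|` (Theorem 1.1). [cite: ForsstromViklund2025currents, Thm. 1.1] -/
theorem curSum_eq (β : ℝ) (γ : Site d L → Fin d → ZMod 2) :
    curSum β γ = loopNumerator β γ / Fintype.card (Site d L → Fin d → ZMod 2) :=
  (hasSum_currentExpansion β γ).tsum_eq

/-! ### Fibres of `n ↦ n mod 2` and the high-temperature expansion (§1.3) -/

/-- **Fibres of the parity map**: for every `ℤ₂` `2`-form `η`,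
`Σ_{n : n mod 2 = η} w(n) = ∏_p c(2β, η(p)) = (cosh 2β)^{#{η = 0}} (sinh 2β)^{#{η = 1}}`.
[cite: ForsstromViklund2025currents, §5 proof of Thm. 1.3 (a), (b)] -/
theorem hasSum_currentWeight_parity (β : ℝ) (η : Plaquette d L → ZMod 2) :
    HasSum (fun n : Current d L => if parity n = η then currentWeight β n else 0)
      (∏ p, parityFactor (2 * β) (η p)) := by
  have h := hasSum_pi_of_summable_norm (Plaquette d L)
    (fun p k => if (k : ZMod 2) = η p then (2 * β) ^ k / (k.factorial : ℝ) else 0)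
    (fun p => parityFactor (2 * β) (η p))
    (fun p => summable_norm_ite_pow_div_factorial _ _)
    (fun p => hasSum_pow_div_factorial_of_parity _ _)
  convert h using 1
  funext n
  rw [Fintype.prod_ite_zero]
  have hiff : parity n = η ↔ ∀ p, ((n p : ℕ) : ZMod 2) = η p := funext_iff
  by_cases hη : parity n = η
  · rw [if_pos hη, if_pos (hiff.mp hη), currentWeight]
  · rw [if_neg hη, if_neg (fun h' => hη (hiff.mpr h'))]

/-- `∏_p c(2β, η(p)) = (cosh 2β)^{|C₂⁺|} (tanh 2β)^{|supp η|}`. [cite: ForsstromViklund2025currents, §1.3 (high-temperature expansion)] -/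
theorem prod_parityFactor_eq (β : ℝ) (η : Plaquette d L → ZMod 2) :
    ∏ p, parityFactor (2 * β) (η p) =
      Real.cosh (2 * β) ^ Fintype.card (Plaquette d L) * htWeight β η := by
  classical
  have hc : Real.cosh (2 * β) ≠ 0 := (Real.cosh_pos _).ne'
  have hcard : (Finset.univ.filter fun p : Plaquette d L => η p = 0).card +
      (Finset.univ.filter fun p : Plaquette d L => ¬η p = 0).card = Fintype.card (Plaquette d L) :=
    Finset.card_filter_add_card_filter_not _
  unfold parityFactor htWeight supp
  rw [Finset.prod_ite, Finset.prod_const, Finset.prod_const, ← hcard, pow_add,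
    Real.tanh_eq_sinh_div_cosh, div_pow]
  have hne : ∀ m : ℕ, Real.cosh (2 * β) ^ m ≠ 0 := fun m => pow_ne_zero _ hc
  field_simp

/-- **Fibres of the parity map inside `𝒞_γ`**: `Σ_{n ∈ 𝒞_γ : n mod 2 = η} w(n) =
𝟙[δη = γ] (cosh 2β)^{|C₂⁺|} (tanh 2β)^{|supp η|}` (`n ∈ 𝒞_γ` depends on `n` only through
`n mod 2`). [cite: ForsstromViklund2025currents, §5 proof of Thm. 1.3 (a)] -/
theorem hasSum_currentWeight_source_parity (β : ℝ) (γ : Site d L → Fin d → ZMod 2)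
    (η : Plaquette d L → ZMod 2) :
    HasSum (fun n : Current d L => if IsSourceOf γ n ∧ parity n = η then currentWeight β n else 0)
      (if bd₂ η = γ then Real.cosh (2 * β) ^ Fintype.card (Plaquette d L) * htWeight β η else 0) := by
  by_cases hη : bd₂ η = γ
  · rw [if_pos hη, ← prod_parityFactor_eq]
    convert hasSum_currentWeight_parity β η using 1
    funext n
    by_cases hp : parity n = η
    · have hs : IsSourceOf γ n := by rw [isSourceOf_iff_parity, hp, hη]
      rw [if_pos ⟨hs, hp⟩, if_pos hp]
    · rw [if_neg (fun h => hp h.2), if_neg hp]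
  · rw [if_neg hη]
    have hfun : (fun n : Current d L => if IsSourceOf γ n ∧ parity n = η then currentWeight β n else 0)
        = fun _ => 0 := by
      funext n
      rw [if_neg]
      rintro ⟨hs, hp⟩
      rw [isSourceOf_iff_parity, hp] at hs
      exact hη hs
    rw [hfun]
    exact hasSum_zero

/-- **`Σ_{n ∈ 𝒞_γ} w(n) = (cosh 2β)^{|C₂⁺|} Σ_{η : δη = γ} (tanh 2β)^{|supp η|}`** (sum the fibres).
[cite: ForsstromViklund2025currents, §1.3 (high-temperature expansion)] -/
theorem curSum_eq_htSum (β : ℝ) (γ : Site d L → Fin d → ZMod 2) :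
    curSum β γ = Real.cosh (2 * β) ^ Fintype.card (Plaquette d L) * htSum β γ := by
  classical
  have h := hasSum_sum (s := (Finset.univ : Finset (Plaquette d L → ZMod 2)))
    (fun η _ => hasSum_currentWeight_source_parity β γ η)
  have hfun : (fun n : Current d L => ∑ η : Plaquette d L → ZMod 2,
      (if IsSourceOf γ n ∧ parity n = η then currentWeight β n else 0)) =
      fun n => if IsSourceOf γ n then currentWeight β n else 0 := by
    funext n
    rw [Finset.sum_eq_single (parity n)]
    · by_cases hs : IsSourceOf γ n
      · rw [if_pos ⟨hs, rfl⟩, if_pos hs]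
      · rw [if_neg (fun h => hs h.1), if_neg hs]
    · intro η _ hne
      rw [if_neg (fun h => hne h.2.symm)]
    · intro h; exact absurd (Finset.mem_univ _) h
  rw [hfun] at h
  unfold curSum
  rw [h.tsum_eq, htSum, Finset.mul_sum]
  refine Finset.sum_congr rfl fun η _ => ?_
  split_ifs <;> ring

/-- **The high-temperature expansion of Ising lattice gauge theory (Forsström–Viklund §1.3, first
display; Marra–Miracle-Solé 1979), PROVED on the torus**: for every `β` and every `ℤ₂` `1`-chain `γ`,
`Z_β[γ] = |Ω¹(𝕋; ℤ₂)| (cosh 2β)^{|C₂⁺|} Σ_{ω : δω = γ} (tanh 2β)^{|supp ω|}`. Proof here: Theorem 1.1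
and the fibres of `n ↦ n mod 2` (`Σ_{k even} (2β)^k/k! = cosh 2β`, `Σ_{k odd} = sinh 2β`).
[cite: ForsstromViklund2025currents, §1.3 (high-temperature expansion); MarraMiraclesole1979, §3 eq. (5)] -/
theorem loopNumerator_eq_htSum (β : ℝ) (γ : Site d L → Fin d → ZMod 2) :
    loopNumerator β γ = Fintype.card (Site d L → Fin d → ZMod 2) *
      (Real.cosh (2 * β) ^ Fintype.card (Plaquette d L) * htSum β γ) := by
  have hcard : (Fintype.card (Site d L → Fin d → ZMod 2) : ℝ) ≠ 0 := by
    exact_mod_cast Fintype.card_ne_zero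
  have h := curSum_eq β γ
  rw [curSum_eq_htSum] at h
  field_simp at h
  linarith [h]

/-! ### Positivity and normalisation for `β > 0` and `γ` a boundary -/

/-- `tanh 2β > 0` for `β > 0`. [cite: ForsstromViklund2025currents, Thm. 1.3 (β > 0)] -/
theorem tanh_two_mul_pos {β : ℝ} (hβ : 0 < β) : 0 < Real.tanh (2 * β) := by
  rw [Real.tanh_eq_sinh_div_cosh]
  exact div_pos (Real.sinh_pos_iff.mpr (by linarith)) (Real.cosh_pos _)

/-- The high-temperature weights are non-negative for `β ≥ 0`. [cite: ForsstromViklund2025currents, §1.3 (P^γ_{B_N,β})] -/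
theorem htWeight_nonneg {β : ℝ} (hβ : 0 ≤ β) (η : Plaquette d L → ZMod 2) : 0 ≤ htWeight β η := by
  unfold htWeight
  refine pow_nonneg ?_ _
  rw [Real.tanh_eq_sinh_div_cosh]
  exact div_nonneg (Real.sinh_nonneg_iff.mpr (by linarith)) (Real.cosh_pos _).le

/-- `Σ_{𝒫^{ht}_γ} (tanh 2β)^{|supp ω|} > 0` when `β > 0` and `γ` is a `ℤ₂`-boundary (`𝒫^{ht}_γ ≠ ∅`).
[cite: ForsstromViklund2025currents, §1.3 (P^γ_{B_N,β})] -/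
theorem htSum_pos {β : ℝ} (hβ : 0 < β) {γ : Site d L → Fin d → ZMod 2}
    (hγ : ∃ c : Plaquette d L → ZMod 2, bd₂ c = γ) : 0 < htSum β γ := by
  classical
  obtain ⟨c, hc⟩ := hγ
  unfold htSum
  have hterm : 0 < (if bd₂ c = γ then htWeight β c else 0) := by
    rw [if_pos hc]
    exact pow_pos (tanh_two_mul_pos hβ) _
  refine lt_of_lt_of_le hterm (Finset.single_le_sum
    (f := fun η : Plaquette d L → ZMod 2 => if bd₂ η = γ then htWeight β η else 0)
    (fun η _ => ?_) (Finset.mem_univ c))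
  show 0 ≤ (if bd₂ η = γ then htWeight β η else 0)
  split_ifs
  · exact htWeight_nonneg hβ.le η
  · exact le_rfl

/-- `Σ_{m ∈ 𝒞_γ} w(m) > 0` when `β > 0` and `γ` is a `ℤ₂`-boundary. [cite: ForsstromViklund2025currents, §1.3 (𝐏^γ_{B_N,β})] -/
theorem curSum_pos {β : ℝ} (hβ : 0 < β) {γ : Site d L → Fin d → ZMod 2}
    (hγ : ∃ c : Plaquette d L → ZMod 2, bd₂ c = γ) : 0 < curSum β γ := by
  rw [curSum_eq_htSum]
  exact mul_pos (pow_pos (Real.cosh_pos _) _) (htSum_pos hβ hγ)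

/-- `P^γ_β` is a probability: `Σ_η P^γ_β(η) = 1`. [cite: ForsstromViklund2025currents, §1.3 (P^γ_{B_N,β})] -/
theorem sum_htProb_eq_one {β : ℝ} (hβ : 0 < β) {γ : Site d L → Fin d → ZMod 2}
    (hγ : ∃ c : Plaquette d L → ZMod 2, bd₂ c = γ) :
    ∑ η : Plaquette d L → ZMod 2, htProb β γ η = 1 := by
  unfold htProb
  rw [← Finset.sum_div, div_eq_one_iff_eq (htSum_pos hβ hγ).ne']
  rfl

/-- `P^γ_β(η) ≥ 0` (`β ≥ 0`). [cite: ForsstromViklund2025currents, §1.3 (P^γ_{B_N,β})] -/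
theorem htProb_nonneg {β : ℝ} (hβ : 0 ≤ β) (γ : Site d L → Fin d → ZMod 2)
    (η : Plaquette d L → ZMod 2) : 0 ≤ htProb β γ η := by
  classical
  unfold htProb htSum
  refine div_nonneg ?_ (Finset.sum_nonneg fun η' _ => ?_)
  · split_ifs
    · exact htWeight_nonneg hβ η
    · exact le_rfl
  · split_ifs
    · exact htWeight_nonneg hβ η'
    · exact le_rfl

/-! ### Theorem 1.3 (a): `n mod 2 ∼ P^γ_β` -/

/-- **Theorem 1.3 (a) (Forsström–Viklund), PROVED on the torus**: for `β > 0` and a `ℤ₂`-boundary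
`γ`, the push-forward of the random-current model `𝐏^γ_β` under `n ↦ n mod 2` is the
high-temperature model: `𝐏^γ_β(n mod 2 = η) = P^γ_β(η)` for every `ℤ₂` `2`-form `η`.
[cite: ForsstromViklund2025currents, Thm. 1.3 (a)] -/
theorem tsum_curProb_parity_eq_htProb {β : ℝ} (hβ : 0 < β) {γ : Site d L → Fin d → ZMod 2}
    (hγ : ∃ c : Plaquette d L → ZMod 2, bd₂ c = γ) (η : Plaquette d L → ZMod 2) :
    ∑' n : Current d L, (if parity n = η then curProb β γ n else 0) = htProb β γ η := by
  have hS := curSum_pos hβ hγ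
  have hc : Real.cosh (2 * β) ^ Fintype.card (Plaquette d L) ≠ 0 := pow_ne_zero _ (Real.cosh_pos _).ne'
  have hnum := (hasSum_currentWeight_source_parity β γ η).div_const (curSum β γ)
  have hfun : (fun n : Current d L => (if IsSourceOf γ n ∧ parity n = η then currentWeight β n else 0) /
      curSum β γ) = fun n => if parity n = η then curProb β γ n else 0 := by
    funext n
    unfold curProb
    by_cases hp : parity n = η
    · by_cases hs : IsSourceOf γ n
      · rw [if_pos ⟨hs, hp⟩, if_pos hp, if_pos hs]
      · rw [if_neg (fun h => hs h.1), if_pos hp, if_neg hs]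
    · rw [if_neg (fun h => hp h.2), if_neg hp, zero_div]
  rw [hfun] at hnum
  rw [hnum.tsum_eq, htProb, curSum_eq_htSum]
  split_ifs
  · field_simp
  · simp

/-! ### Theorem 1.3 (b): `n̂ ∼ max(η, X₁)`, `X₁ ∼ Ψ_{1 - 1/cosh 2β}` -/

/-- **Fibres of `n ↦ (n mod 2, n̂)`**: `Σ_{n : n mod 2 = η, n̂ = P} w(n) = ∏_p t(2β, η(p), p ∈ P)`.
[cite: ForsstromViklund2025currents, §5 proof of Thm. 1.3 (b)] -/
theorem hasSum_currentWeight_parity_supp (β : ℝ) (η : Plaquette d L → ZMod 2)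
    (P : Finset (Plaquette d L)) :
    HasSum (fun n : Current d L => if parity n = η ∧ supp n = P then currentWeight β n else 0)
      (∏ p, traceFactor (2 * β) (η p) (p ∈ P)) := by
  have h := hasSum_pi_of_summable_norm (Plaquette d L)
    (fun p k => if (k : ZMod 2) = η p ∧ (k ≠ 0 ↔ p ∈ P) then (2 * β) ^ k / (k.factorial : ℝ) else 0)
    (fun p => traceFactor (2 * β) (η p) (p ∈ P))
    (fun p => summable_norm_ite_pow_div_factorial _ _)
    (fun p => hasSum_pow_div_factorial_of_parity_of_iff _ _ _)
  convert h using 1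
  funext n
  rw [Fintype.prod_ite_zero]
  have hiff : (parity n = η ∧ supp n = P) ↔ ∀ p, (((n p : ℕ) : ZMod 2) = η p ∧ (n p ≠ 0 ↔ p ∈ P)) := by
    rw [funext_iff, Finset.ext_iff]
    simp only [parity, mem_supp]
    exact ⟨fun h p => ⟨h.1 p, h.2 p⟩, fun h => ⟨fun p => (h p).1, fun p => (h p).2⟩⟩
  by_cases hη : parity n = η ∧ supp n = P
  · rw [if_pos hη, if_pos (hiff.mp hη), currentWeight]
  · rw [if_neg hη, if_neg (fun h' => hη (hiff.mpr h'))]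

/-- **The product of the trace factors**: `∏_p t(2β, η(p), p ∈ P) =
𝟙[supp η ⊆ P] (sinh 2β)^{|supp η|} (cosh 2β - 1)^{|P ∖ supp η|}`.
[cite: ForsstromViklund2025currents, §5 proof of Thm. 1.3 (b)] -/
theorem prod_traceFactor_eq (β : ℝ) (η : Plaquette d L → ZMod 2) (P : Finset (Plaquette d L)) :
    ∏ p, traceFactor (2 * β) (η p) (p ∈ P) =
      if supp η ⊆ P then
        Real.sinh (2 * β) ^ (supp η).card * (Real.cosh (2 * β) - 1) ^ (P \ supp η).card
      else 0 := by
  classical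
  split_ifs with hsub
  · unfold traceFactor
    rw [Finset.prod_ite, Finset.prod_ite, Finset.prod_const, Finset.prod_const_one, mul_one]
    have h1 : ((Finset.univ.filter fun p : Plaquette d L => η p = 0).filter fun p => p ∈ P) =
        P \ supp η := by
      ext p
      simp only [Finset.mem_filter, Finset.mem_univ, true_and, Finset.mem_sdiff, mem_supp, ne_eq,
        not_not]
      tauto
    have h2 : (Finset.univ.filter fun p : Plaquette d L => ¬η p = 0) = supp η := by
      ext p; simp [supp]
    have h3 : (∏ p ∈ Finset.univ.filter (fun p : Plaquette d L => ¬η p = 0),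
        (if p ∈ P then Real.sinh (2 * β) else 0)) = Real.sinh (2 * β) ^ (supp η).card := by
      rw [← h2, ← Finset.prod_const]
      refine Finset.prod_congr rfl fun p hp => ?_
      rw [Finset.mem_filter] at hp
      rw [if_pos (hsub ((mem_supp η p).mpr hp.2))]
    rw [h1, h3, mul_comm]
  · obtain ⟨p, hp, hpP⟩ := Finset.not_subset.mp hsub
    refine Finset.prod_eq_zero (Finset.mem_univ p) ?_
    unfold traceFactor
    rw [if_neg ((mem_supp η p).mp hp), if_neg hpP]

/-- **Bernoulli sprinkling on top of a fixed set**: under `Ψ_r` the event `{X : S ∪ X = P}` has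
probability `𝟙[S ⊆ P] r^{|P ∖ S|} (1-r)^{|Pᶜ|}` (the law of `max(η, X)` given `η`).
[cite: ForsstromViklund2025currents, Thm. 1.3 (b) (max(η, X₁))] -/
theorem bernoulli_eventProb_union_eq (F : Type*) [Field F] (r : ℝ) (S P : Finset (Plaquette d L)) :
    eventProb F r 1 {X | S ∪ X = P} =
      if S ⊆ P then r ^ (P \ S).card * (1 - r) ^ Pᶜ.card else 0 := by
  classical
  unfold eventProb prob
  simp only [partitionFn_one, div_one, Set.mem_setOf_eq]
  unfold weight
  simp only [one_pow, mul_one]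
  rw [← Finset.sum_filter]
  split_ifs with hSP
  · have hPS : (P \ S).card + S.card = P.card := by
      rw [Finset.card_sdiff_add_card_eq_card hSP]   -- card (P \ S) + card S = card P for S ⊆ P
    have hPc : P.card + Pᶜ.card = Fintype.card (Plaquette d L) := by
      rw [Finset.card_add_card_compl]
    have key : ∑ X ∈ Finset.univ.filter (fun X : Finset (Plaquette d L) => S ∪ X = P),
        r ^ X.card * (1 - r) ^ Xᶜ.card =
        ∑ Y ∈ S.powerset, r ^ (P \ S).card * (1 - r) ^ Pᶜ.card *
          (r ^ Y.card * (1 - r) ^ (S.card - Y.card)) := by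
      refine Finset.sum_nbij' (fun X => X ∩ S) (fun Y => (P \ S) ∪ Y) ?_ ?_ ?_ ?_ ?_
      · intro X _
        rw [Finset.mem_powerset]
        exact Finset.inter_subset_right
      · intro Y hY
        rw [Finset.mem_powerset] at hY
        simp only [Finset.mem_filter, Finset.mem_univ, true_and]
        ext p
        simp only [Finset.mem_union, Finset.mem_sdiff]
        constructor
        · rintro (h | ⟨h, _⟩ | h)
          · exact hSP h
          · exact h
          · exact hSP (hY h)
        · intro h
          by_cases hpS : p ∈ S
          · exact Or.inl hpS
          · exact Or.inr (Or.inl ⟨h, hpS⟩)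
      · intro X hX
        simp only [Finset.mem_filter, Finset.mem_univ, true_and] at hX
        ext p
        simp only [Finset.mem_union, Finset.mem_sdiff, Finset.mem_inter]
        constructor
        · rintro (⟨hpP, hpS⟩ | ⟨hpX, _⟩)
          · rw [← hX] at hpP
            rcases Finset.mem_union.mp hpP with h | h
            · exact absurd h hpS
            · exact h
          · exact hpX
        · intro hpX
          by_cases hpS : p ∈ S
          · exact Or.inr ⟨hpX, hpS⟩
          · exact Or.inl ⟨by rw [← hX]; exact Finset.mem_union_right _ hpX, hpS⟩
      · intro Y hY
        rw [Finset.mem_powerset] at hY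
        rw [Finset.union_inter_distrib_right]
        have h1 : P \ S ∩ S = ∅ := by
          ext p; simp
        rw [h1, Finset.empty_union, Finset.inter_eq_left.mpr hY]
      · intro X hX
        simp only [Finset.mem_filter, Finset.mem_univ, true_and] at hX
        have hXP : X ⊆ P := by rw [← hX]; exact Finset.subset_union_right
        have hdisj : Disjoint (P \ S) (X ∩ S) := by
          rw [Finset.disjoint_left]
          intro p hp hp'
          exact (Finset.mem_sdiff.mp hp).2 (Finset.mem_inter.mp hp').2
        have hXeq : X = (P \ S) ∪ (X ∩ S) := by
          ext p
          simp only [Finset.mem_union, Finset.mem_sdiff, Finset.mem_inter]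
          constructor
          · intro hpX
            by_cases hpS : p ∈ S
            · exact Or.inr ⟨hpX, hpS⟩
            · exact Or.inl ⟨hXP hpX, hpS⟩
          · rintro (⟨hpP, hpS⟩ | ⟨hpX, _⟩)
            · rw [← hX] at hpP
              rcases Finset.mem_union.mp hpP with h | h
              · exact absurd h hpS
              · exact h
            · exact hpX
        have hcardX : X.card = (P \ S).card + (X ∩ S).card := by
          conv_lhs => rw [hXeq]
          exact Finset.card_union_of_disjoint hdisj
        have hYle : (X ∩ S).card ≤ S.card := Finset.card_le_card Finset.inter_subset_right
        have hcardXc : Xᶜ.card = Pᶜ.card + (S.card - (X ∩ S).card) := by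
          have := Finset.card_add_card_compl X
          omega
        rw [hcardX, hcardXc, pow_add, pow_add]
        ring
    rw [key, ← Finset.mul_sum, Finset.sum_pow_mul_eq_add_pow, add_sub_cancel, one_pow, mul_one]
  · refine Finset.sum_eq_zero fun X hX => ?_
    simp only [Finset.mem_filter, Finset.mem_univ, true_and] at hX
    exact absurd (hX ▸ Finset.subset_union_left) hSP

/-- **Theorem 1.3 (b) (Forsström–Viklund), PROVED on the torus, as the push-forward identity**: for
`β > 0`, a `ℤ₂`-boundary `γ` and every plaquette set `P`,
`𝐏^γ_β(n̂ = P) = Σ_η P^γ_β(η) Ψ_{1-1/cosh 2β}({X : supp η ∪ X = P})` — the law `𝐏̂^γ_β` of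
`n̂ = 𝟙(n > 0)` is the law of `max(η, X₁)` for `η ∼ P^γ_β` and an independent Bernoulli plaquette
percolation `X₁ ∼ Ψ_{1-1/cosh 2β}`. Proof as printed: condition on `n mod 2 = η` (Theorem 1.3 (a));
given the parities the multiplicities are independent, `n̂(p) = 1` when `n(p)` is odd, and
`𝐏(n(p) ≥ 2 ∣ n(p) even) = (cosh 2β - 1)/cosh 2β`. [cite: ForsstromViklund2025currents, Thm. 1.3 (b)] -/
theorem hasSum_curProb_supp {β : ℝ} (hβ : 0 < β) {γ : Site d L → Fin d → ZMod 2}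
    (hγ : ∃ c : Plaquette d L → ZMod 2, bd₂ c = γ) (P : Finset (Plaquette d L)) :
    HasSum (fun n : Current d L => if supp n = P then curProb β γ n else 0)
      (∑ η : Plaquette d L → ZMod 2, htProb β γ η *
        eventProb (ZMod 2) (1 - (Real.cosh (2 * β))⁻¹) 1 {X | supp η ∪ X = P}) := by
  classical
  have hS := curSum_pos hβ hγ
  have hcpos : 0 < Real.cosh (2 * β) := Real.cosh_pos _
  have hc : Real.cosh (2 * β) ≠ 0 := hcpos.ne'
  have hT := htSum_pos hβ hγ
  -- the fibre sums, restricted to `𝒞_γ`, summed over the parities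
  have hfib : ∀ η : Plaquette d L → ZMod 2,
      HasSum (fun n : Current d L =>
        if IsSourceOf γ n ∧ (parity n = η ∧ supp n = P) then currentWeight β n else 0)
        (if bd₂ η = γ then ∏ p, traceFactor (2 * β) (η p) (p ∈ P) else 0) := by
    intro η
    by_cases hη : bd₂ η = γ
    · rw [if_pos hη]
      convert hasSum_currentWeight_parity_supp β η P using 1
      funext n
      by_cases hp : parity n = η ∧ supp n = P
      · have hs : IsSourceOf γ n := by rw [isSourceOf_iff_parity, hp.1, hη]
        rw [if_pos ⟨hs, hp⟩, if_pos hp]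
      · rw [if_neg (fun h => hp h.2), if_neg hp]
    · rw [if_neg hη]
      have hfun : (fun n : Current d L =>
          if IsSourceOf γ n ∧ (parity n = η ∧ supp n = P) then currentWeight β n else 0) = fun _ => 0 := by
        funext n
        rw [if_neg]
        rintro ⟨hs, hp, _⟩
        rw [isSourceOf_iff_parity, hp] at hs
        exact hη hs
      rw [hfun]
      exact hasSum_zero
  have h := (hasSum_sum (s := (Finset.univ : Finset (Plaquette d L → ZMod 2)))
    (fun η _ => hfib η)).div_const (curSum β γ)
  have hfun : (fun n : Current d L => (∑ η : Plaquette d L → ZMod 2,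
      (if IsSourceOf γ n ∧ (parity n = η ∧ supp n = P) then currentWeight β n else 0)) / curSum β γ) =
      fun n => if supp n = P then curProb β γ n else 0 := by
    funext n
    rw [Finset.sum_eq_single (parity n)]
    · unfold curProb
      by_cases hP : supp n = P
      · by_cases hs : IsSourceOf γ n
        · rw [if_pos ⟨hs, rfl, hP⟩, if_pos hP, if_pos hs]
        · rw [if_neg (fun h => hs h.1), if_pos hP, if_neg hs]
      · rw [if_neg (fun h => hP h.2.2), if_neg hP, zero_div]
    · intro η _ hne
      rw [if_neg (fun h => hne h.2.1.symm)]
    · intro h; exact absurd (Finset.mem_univ _) h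
  rw [hfun] at h
  have hval : (∑ η : Plaquette d L → ZMod 2,
      (if bd₂ η = γ then ∏ p, traceFactor (2 * β) (η p) (p ∈ P) else 0)) / curSum β γ =
      ∑ η : Plaquette d L → ZMod 2, htProb β γ η *
        eventProb (ZMod 2) (1 - (Real.cosh (2 * β))⁻¹) 1 {X | supp η ∪ X = P} := by
    rw [Finset.sum_div]
    refine Finset.sum_congr rfl fun η _ => ?_
    rw [bernoulli_eventProb_union_eq, htProb, curSum_eq_htSum, prod_traceFactor_eq]
    by_cases hη : bd₂ η = γ
    · rw [if_pos hη, if_pos hη]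
      by_cases hsub : supp η ⊆ P
      · rw [if_pos hsub, if_pos hsub, htWeight]
        -- the algebra: `t^a ((c-1)/c)^b (1/c)^e / T = s^a (c-1)^b / (c^{a+b+e} T)`
        have hcardP : (P \ supp η).card + (supp η).card = P.card :=
          Finset.card_sdiff_add_card_eq_card hsub
        have hcardC : P.card + Pᶜ.card = Fintype.card (Plaquette d L) := Finset.card_add_card_compl P
        have hC : Fintype.card (Plaquette d L) = (supp η).card + (P \ supp η).card + Pᶜ.card := by
          omega
        rw [hC, pow_add, pow_add, Real.tanh_eq_sinh_div_cosh, div_pow,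
          show (1 - (Real.cosh (2 * β))⁻¹) = (Real.cosh (2 * β) - 1) / Real.cosh (2 * β) by
            field_simp,
          show (1 - (Real.cosh (2 * β) - 1) / Real.cosh (2 * β)) = 1 / Real.cosh (2 * β) by
            field_simp; ring,
          div_pow, div_pow, one_pow]
        field_simp
      · rw [if_neg hsub, if_neg hsub, mul_zero, zero_div]
    · rw [if_neg hη, if_neg hη, zero_div, zero_div, zero_mul]
  rw [hval] at h
  exact h

/-- **Theorem 1.3 (b), `tsum` form**: `𝐏^γ_β(n̂ = P) = (P^γ_β ⊗ Ψ_{1-1/cosh 2β})(supp η ∪ X = P)`.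
[cite: ForsstromViklund2025currents, Thm. 1.3 (b)] -/
theorem tsum_curProb_supp_eq {β : ℝ} (hβ : 0 < β) {γ : Site d L → Fin d → ZMod 2}
    (hγ : ∃ c : Plaquette d L → ZMod 2, bd₂ c = γ) (P : Finset (Plaquette d L)) :
    ∑' n : Current d L, (if supp n = P then curProb β γ n else 0) =
      ∑ η : Plaquette d L → ZMod 2, htProb β γ η *
        eventProb (ZMod 2) (1 - (Real.cosh (2 * β))⁻¹) 1 {X | supp η ∪ X = P} :=
  (hasSum_curProb_supp hβ hγ P).tsum_eq

/-- Additivity of `Ψ_r` over the value of `supp η ∪ X`: `Σ_{P ∈ E} Ψ_r(S ∪ X = P) = Ψ_r(S ∪ X ∈ E)`.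
[cite: ForsstromViklund2025currents, Thm. 1.3 (b)] -/
theorem sum_eventProb_union_eq (F : Type*) [Field F] (r q : ℝ) (S : Finset (Plaquette d L))
    (E : Set (Finset (Plaquette d L))) [DecidablePred (· ∈ E)] :
    ∑ P ∈ Finset.univ.filter (fun P : Finset (Plaquette d L) => P ∈ E), eventProb F r q {X | S ∪ X = P} =
      eventProb F r q {X | S ∪ X ∈ E} := by
  classical
  unfold eventProb
  rw [Finset.sum_comm]
  refine Finset.sum_congr rfl fun X _ => ?_
  by_cases hX : S ∪ X ∈ E
  · rw [if_pos (show X ∈ {X | S ∪ X ∈ E} from hX)]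
    rw [Finset.sum_eq_single_of_mem (S ∪ X) (Finset.mem_filter.mpr ⟨Finset.mem_univ _, hX⟩)]
    · exact if_pos (show X ∈ {X' | S ∪ X' = S ∪ X} from rfl)
    · intro P _ hP
      exact if_neg (show X ∉ {X' | S ∪ X' = P} from fun h => hP h.symm)
  · rw [if_neg (show X ∉ {X | S ∪ X ∈ E} from hX)]
    refine Finset.sum_eq_zero fun P hP => ?_
    refine if_neg (show X ∉ {X' | S ∪ X' = P} from fun h => ?_)
    rw [Finset.mem_filter] at hP
    exact hX (h ▸ hP.2)

/-! ### The percolation law `𝐏̂^γ_β` and Proposition 6.7 (lower half) -/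

/-- **`𝐏̂^γ_β` through the coupling**: for `β > 0`, a `ℤ₂`-boundary `γ` and every event `E` of
plaquette sets, `𝐏̂^γ_β(E) = (P^γ_β ⊗ Ψ_{1-1/cosh 2β})(supp η ∪ X ∈ E)`.
[cite: ForsstromViklund2025currents, Thm. 1.3 (b)] -/
theorem percProb_eq_sum {β : ℝ} (hβ : 0 < β) {γ : Site d L → Fin d → ZMod 2}
    (hγ : ∃ c : Plaquette d L → ZMod 2, bd₂ c = γ) (E : Set (Finset (Plaquette d L)))
    [DecidablePred (· ∈ E)] :
    percProb β γ E = ∑ η : Plaquette d L → ZMod 2, htProb β γ η *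
      eventProb (ZMod 2) (1 - (Real.cosh (2 * β))⁻¹) 1 {X | supp η ∪ X ∈ E} := by
  classical
  have h := hasSum_sum (s := Finset.univ.filter (fun P : Finset (Plaquette d L) => P ∈ E))
    (fun P _ => hasSum_curProb_supp hβ hγ P)
  have hfun : (fun n : Current d L => ∑ P ∈ Finset.univ.filter (fun P : Finset (Plaquette d L) => P ∈ E),
      (if supp n = P then curProb β γ n else 0)) = fun n => if supp n ∈ E then curProb β γ n else 0 := by
    funext n
    by_cases hn : supp n ∈ E
    · rw [if_pos hn, Finset.sum_eq_single_of_mem (supp n)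
        (Finset.mem_filter.mpr ⟨Finset.mem_univ _, hn⟩)]
      · rw [if_pos rfl]
      · intro P _ hP
        rw [if_neg (Ne.symm hP)]
    · rw [if_neg hn]
      refine Finset.sum_eq_zero fun P hP => ?_
      rw [if_neg]
      rintro rfl
      exact hn (Finset.mem_filter.mp hP).2
  rw [hfun] at h
  unfold percProb
  rw [h.tsum_eq, Finset.sum_comm]
  refine Finset.sum_congr rfl fun η _ => ?_
  rw [← Finset.mul_sum, sum_eventProb_union_eq]

/-- `1 - 1/cosh 2β ∈ [0, 1]`. [cite: ForsstromViklund2025currents, Thm. 1.3 (X₁ ∼ Ψ_{1-1/cosh 2β})] -/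
theorem one_sub_inv_cosh_mem_Icc (β : ℝ) : 1 - (Real.cosh (2 * β))⁻¹ ∈ Set.Icc (0 : ℝ) 1 := by
  constructor
  · rw [sub_nonneg]
    exact inv_le_one_of_one_le₀ (Real.one_le_cosh _)
  · rw [sub_le_self_iff]
    exact inv_nonneg.mpr (Real.cosh_pos _).le

/-- **Proposition 6.7, lower half (Forsström–Viklund), PROVED on the torus for every boundary `γ`**
(printed for `γ = 0`): for `β > 0` and every increasing event `E` of plaquette sets,
`Ψ_{1-1/cosh 2β}(E) ≤ 𝐏̂^γ_β(E)` — the random-current percolation `n̂` stochastically dominates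
Bernoulli plaquette percolation with density `1 - 1/cosh 2β` (proof as printed: `n̂ = max(η, X₁) ≥ X₁`
in the coupling of Theorem 1.3 (b)). [cite: ForsstromViklund2025currents, Prop. 6.7] -/
theorem bernoulli_le_percProb {β : ℝ} (hβ : 0 < β) {γ : Site d L → Fin d → ZMod 2}
    (hγ : ∃ c : Plaquette d L → ZMod 2, bd₂ c = γ) {E : Set (Finset (Plaquette d L))}
    [DecidablePred (· ∈ E)] (hE : IsUpperSet E) :
    eventProb (ZMod 2) (1 - (Real.cosh (2 * β))⁻¹) 1 E ≤ percProb β γ E := by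
  rw [percProb_eq_sum hβ hγ E]
  have hp := one_sub_inv_cosh_mem_Icc β
  calc eventProb (ZMod 2) (1 - (Real.cosh (2 * β))⁻¹) 1 E
      = ∑ η : Plaquette d L → ZMod 2, htProb β γ η *
          eventProb (ZMod 2) (1 - (Real.cosh (2 * β))⁻¹) 1 E := by
        rw [← Finset.sum_mul, sum_htProb_eq_one hβ hγ, one_mul]
    _ ≤ ∑ η : Plaquette d L → ZMod 2, htProb β γ η *
          eventProb (ZMod 2) (1 - (Real.cosh (2 * β))⁻¹) 1 {X | supp η ∪ X ∈ E} := by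
        refine Finset.sum_le_sum fun η _ => mul_le_mul_of_nonneg_left ?_ (htProb_nonneg hβ.le γ η)
        refine eventProb_mono_set (ZMod 2) hp zero_le_one ?_
        intro X hX
        exact hE (Finset.subset_union_right : X ≤ supp η ∪ X) hX

end IsingGaugeCurrents

end Literature.MathematicalPhysics.QuantumFieldTheory
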